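import Summits.ResolutionOfSingularities.ResolutionOfSingularities.Theorems.FrobeniusLadderFInjectiveMacaulayficationMonomialChartPresentationKernel
import Summits.ResolutionOfSingularities.ResolutionOfSingularities.Theorems.FrobeniusLadderFInjectiveMacaulayficationCIPolyKit
import Summits.ResolutionOfSingularities.ResolutionOfSingularities.Theorems.FrobeniusLadderFInjectiveMacaulayficationKLocCellKit
import Literature.AlgebraicGeometry.Resolution.AffineBlowupAlgebra
import HarnessLib

/-!
# [OURS · L1 W4.5a] E7 R3 data kit `ChartModelNumerators` — from the POLYNOMIAL MODEL of a Rees chart (C1 currency,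
# `θ(q̄) = Ψ q`) to NUMERATOR FORM (`reesChartEquiv (Away.mk K x)`), on term lists; and the «Laurent-graph» primes

Crux `FrobeniusLadder.FInjectiveMacaulayfication` = stmt-ResolutionOfSingularities-15315 (chain w45a), hole 5e, E7 T₁₁/3 instance, R3 DATA
HALF (res-L1-w45a-plan-1 R13.19, res-L1-w45a-lead-1 NAMING 13:16:28Z). Helper `--supports stmt-ResolutionOfSingularities-15315 --as helper`,
typed by res-type-034. OURS: replaces the role of NOTHING in H. Hironaka's manuscript and is NOT a statement of it; AI-written kernel glue
of the cell `res-hironaka`, weaker than expert review. No definition, no named fact.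

THE POINT. The restriction lemma `AffineBlowupChartRestriction.map_ideal_closure_eq_of_memberships` (p532056) reads chart elements in
NUMERATOR FORM `reesChartEquiv u (Away.mk K x)`, `x ∈ R̄[It]_K`; the T₁₁/3 instance holds its chart data in the MODEL currency of (C1)
`MonomialChartPresentationKernel.exists_monomialChartPresentation`: `θ : k[y]⧸(g) → R̄[I_A R̄/x̄^m]` with `(θ q̄).val = Ψ q`,
`Ψ(yᵢ) = x̄^{aᵢ}/1 · (x̄^m/1)⁻¹`, polynomials as TERM LISTS `KLocCellKit.evalL`. This file is the dictionary between the two: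
* §1 `psi_evalL_mul_pow` — `Ψ(evalL L) · (x̄^m/1)^K = (mk (evalL NL))/1` whenever the x-term list `NL` is the NUMERATOR of the
  y-term list `L` at height `K`: termwise same coefficient and exponent `Σᵢ eᵢ·aᵢ + (K − |e|)·m` (a `List.Forall₂` relation,
  `decide`-able on literal data, in the style of `CIPolyKit.theta_evalL`);
* §2 `mk_evalL_mem_pow` — such a numerator lies in `(I_A R̄)^K`; **`theta_mk_evalL_eq_reesChartEquiv`** — hence
  `θ (mk (evalL L)) = reesChartEquiv x̄^m _ (Away.mk K ⟨monomial K (mk (evalL NL)), _⟩ _)`: the numerator form of a model element;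
* §3 `ker_laurentGraph_eq` / **`isPrime_span_laurentGraph`** / `not_mem_span_laurentGraph_of_monomial` — the «laurent-graph» prime
  certificate of the cert made generic: for `S ⊆ Fin n`, `r ∉ S` and a monomial `y^μ` in the variables outside `S ∪ {r}`, the ideal
  `(y_s : s ∈ S) + (y^μ·y_r + 1)` is the kernel of `k[y] → k[y][1/y^μ]`, `y_s ↦ 0`, `y_r ↦ −(y^μ)⁻¹` (left inverse = the localisation
  lift of the quotient map), hence PRIME, and a monomial avoiding `y_S` is not in it.
References: folklore (toric charts; graphs of Laurent monomials).
-/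

-- single-problem summit: the doubled namespace component is forced
set_option linter.dupNamespace false

noncomputable section

open MvPolynomial Literature.AlgebraicGeometry.Resolution
open Summit.ResolutionOfSingularities.ResolutionOfSingularities.Theorems.FInjectiveMacaulayfication

namespace Summit.ResolutionOfSingularities.ResolutionOfSingularities.Theorems.FInjectiveMacaulayfication.ChartModelNumerators

/-! ## §1 `Ψ` on a term list, numerator form -/

section Psi

variable {k : Type} [Field k] {n : ℕ} (f : MvPolynomial (Fin n) k) (m : Fin n →₀ ℕ) (a : Fin n → (Fin n →₀ ℕ))

/-- **`Ψ` on one monomial, at height `K ≥ |e|`**: `Ψ(c·y^e) · (x̄^m/1)^K = (c·x̄^β)/1` with `β = Σᵢ eᵢ·aᵢ + (K − |e|)·m`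
(`MonomialChartPresentationRange.psi_monomial_mul_pow` plus padding by `(x̄^m)^{K−|e|}`). [folklore] -/
theorem psi_monomial_mul_pow (c : k) (e : Fin n →₀ ℕ) (K : ℕ) (hK : ∑ i : Fin n, e i ≤ K) :
    aeval (fun i : Fin n => algebraMap (MvPolynomial (Fin n) k ⧸ Ideal.span {f})
        (Localization.Away (Ideal.Quotient.mk (Ideal.span {f}) (monomial m (1 : k))))
        (Ideal.Quotient.mk (Ideal.span {f}) (monomial (a i) (1 : k))) *
      IsLocalization.Away.invSelf (Ideal.Quotient.mk (Ideal.span {f}) (monomial m (1 : k)))) (monomial e c) *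
      (algebraMap (MvPolynomial (Fin n) k ⧸ Ideal.span {f})
        (Localization.Away (Ideal.Quotient.mk (Ideal.span {f}) (monomial m (1 : k))))
        (Ideal.Quotient.mk (Ideal.span {f}) (monomial m (1 : k)))) ^ K =
      algebraMap (MvPolynomial (Fin n) k ⧸ Ideal.span {f})
        (Localization.Away (Ideal.Quotient.mk (Ideal.span {f}) (monomial m (1 : k))))
        (Ideal.Quotient.mk (Ideal.span {f}) (monomial (∑ i : Fin n, e i • a i + (K - ∑ i : Fin n, e i) • m) c)) := by
  set R := MvPolynomial (Fin n) k ⧸ Ideal.span {f}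
  set u : R := Ideal.Quotient.mk (Ideal.span {f}) (monomial m (1 : k)) with hu
  set L := Localization.Away u
  have h1 := MonomialChartPresentationRange.psi_monomial_mul_pow (k := k) f m a e
  -- `monomial e c = C c * monomial e 1`
  have hce : (monomial e c : MvPolynomial (Fin n) k) = C c * monomial e 1 := by
    rw [C_mul_monomial, mul_one]
  have hK' : K = (∑ i : Fin n, e i) + (K - ∑ i : Fin n, e i) := (Nat.add_sub_cancel' hK).symm
  rw [hce, map_mul, mul_assoc, hK', pow_add, ← mul_assoc (aeval _ (monomial e 1)), h1, aeval_C, ← map_pow, ← map_mul,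
    ← map_pow, ← map_mul, ← hK']
  rw [IsScalarTower.algebraMap_apply k R L, IsScalarTower.algebraMap_apply k (MvPolynomial (Fin n) k) R,
    Ideal.Quotient.algebraMap_eq, MvPolynomial.algebraMap_eq, ← map_mul, ← map_mul, monomial_pow, one_pow, monomial_mul, mul_one,
    C_mul_monomial, mul_one]

/-- **`Ψ` ON A TERM LIST, NUMERATOR FORM.** If the x-term list `NL` is the numerator of the y-term list `L` at height `K` — termwise
the same integer coefficient, total degree `≤ K`, and exponent `βⱼ = Σᵢ eᵢ·(aᵢ)ⱼ + (K − |e|)·mⱼ` (a `decide`-able `List.Forall₂`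
relation) — then `Ψ(evalL L) · (x̄^m/1)^K = (mk (evalL NL))/1`. [folklore] -/
theorem psi_evalL_mul_pow (K : ℕ) :
    ∀ (L NL : List (ℤ × (Fin n → ℕ))),
    List.Forall₂ (fun t s : ℤ × (Fin n → ℕ) => s.1 = t.1 ∧ (∑ i : Fin n, t.2 i) ≤ K ∧
      ∀ j : Fin n, s.2 j = (∑ i : Fin n, t.2 i * a i j) + (K - ∑ i : Fin n, t.2 i) * m j) L NL →
    aeval (fun i : Fin n => algebraMap (MvPolynomial (Fin n) k ⧸ Ideal.span {f})
        (Localization.Away (Ideal.Quotient.mk (Ideal.span {f}) (monomial m (1 : k))))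
        (Ideal.Quotient.mk (Ideal.span {f}) (monomial (a i) (1 : k))) *
      IsLocalization.Away.invSelf (Ideal.Quotient.mk (Ideal.span {f}) (monomial m (1 : k))))
        ((L.map fun t : ℤ × (Fin n → ℕ) =>
          (monomial (Finsupp.equivFunOnFinite.symm t.2) ((t.1 : ℤ) : k) : MvPolynomial (Fin n) k)).sum) *
      (algebraMap (MvPolynomial (Fin n) k ⧸ Ideal.span {f})
        (Localization.Away (Ideal.Quotient.mk (Ideal.span {f}) (monomial m (1 : k))))
        (Ideal.Quotient.mk (Ideal.span {f}) (monomial m (1 : k)))) ^ K =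
      algebraMap (MvPolynomial (Fin n) k ⧸ Ideal.span {f})
        (Localization.Away (Ideal.Quotient.mk (Ideal.span {f}) (monomial m (1 : k))))
        (Ideal.Quotient.mk (Ideal.span {f})
          ((NL.map fun t : ℤ × (Fin n → ℕ) =>
            (monomial (Finsupp.equivFunOnFinite.symm t.2) ((t.1 : ℤ) : k) : MvPolynomial (Fin n) k)).sum)) := by
  intro L NL h
  set Ψ := aeval (R := k) (fun i : Fin n => algebraMap (MvPolynomial (Fin n) k ⧸ Ideal.span {f})
      (Localization.Away (Ideal.Quotient.mk (Ideal.span {f}) (monomial m (1 : k))))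
      (Ideal.Quotient.mk (Ideal.span {f}) (monomial (a i) (1 : k))) *
      IsLocalization.Away.invSelf (Ideal.Quotient.mk (Ideal.span {f}) (monomial m (1 : k)))) with hΨ
  induction h with
  | nil => simp
  | @cons t s L NL hts _ ih =>
    obtain ⟨hcoef, hdeg, hexp⟩ := hts
    have hsum : (∑ i : Fin n, (Finsupp.equivFunOnFinite.symm t.2 : Fin n →₀ ℕ) i) = ∑ i : Fin n, t.2 i :=
      Finset.sum_congr rfl fun i _ => by rw [Finsupp.coe_equivFunOnFinite_symm]
    -- the exponent of the numerator term
    have hβ : (Finsupp.equivFunOnFinite.symm s.2 : Fin n →₀ ℕ) =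
        ∑ i : Fin n, (Finsupp.equivFunOnFinite.symm t.2 : Fin n →₀ ℕ) i • a i +
          (K - ∑ i : Fin n, (Finsupp.equivFunOnFinite.symm t.2 : Fin n →₀ ℕ) i) • m := by
      ext j
      rw [Finsupp.coe_equivFunOnFinite_symm, hexp j, hsum, Finsupp.add_apply, Finsupp.smul_apply, Finsupp.finsetSum_apply,
        smul_eq_mul]
      congr 1
    have key := psi_monomial_mul_pow f m a ((t.1 : ℤ) : k) (Finsupp.equivFunOnFinite.symm t.2) K (by rw [hsum]; exact hdeg)
    rw [← hΨ] at key
    have hadd : ∀ x y : MvPolynomial (Fin n) k, Ψ (x + y) = Ψ x + Ψ y := fun x y => Ψ.toRingHom.map_add x y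
    rw [List.map_cons, List.sum_cons, List.map_cons, List.sum_cons, hadd, add_mul, ih, key, hcoef, hβ,
      (Ideal.Quotient.mk (Ideal.span {f})).map_add,
      (algebraMap (MvPolynomial (Fin n) k ⧸ Ideal.span {f})
        (Localization.Away (Ideal.Quotient.mk (Ideal.span {f}) (monomial m (1 : k))))).map_add]

end Psi

/-! ## §2 The numerator lies in `(I_A R̄)^K`; the numerator form of a model element -/

section Numerator

variable {k : Type} [Field k] {n : ℕ} (f : MvPolynomial (Fin n) k) (m : Fin n →₀ ℕ) (a : Fin n → (Fin n →₀ ℕ))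
  (A : Finset (Fin n →₀ ℕ)) (haA : ∀ i, a i ∈ A) (hmA : m ∈ A)

include haA hmA in
/-- **The numerator of a term list lies in `(I_A R̄)^K`** (`I_A R̄ = (x̄^e : e ∈ A)`): each term `c·x̄^{Σ eᵢ aᵢ + (K−|e|) m}` is `c`
times a product of `K` generators `x̄^{aᵢ}`, `x̄^m` of `I_A R̄`. [folklore] -/
theorem mk_evalL_mem_pow (K : ℕ) :
    ∀ (L NL : List (ℤ × (Fin n → ℕ))),
    List.Forall₂ (fun t s : ℤ × (Fin n → ℕ) => s.1 = t.1 ∧ (∑ i : Fin n, t.2 i) ≤ K ∧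
      ∀ j : Fin n, s.2 j = (∑ i : Fin n, t.2 i * a i j) + (K - ∑ i : Fin n, t.2 i) * m j) L NL →
    Ideal.Quotient.mk (Ideal.span {f})
        ((NL.map fun t : ℤ × (Fin n → ℕ) =>
          (monomial (Finsupp.equivFunOnFinite.symm t.2) ((t.1 : ℤ) : k) : MvPolynomial (Fin n) k)).sum) ∈
      (Ideal.span ((fun e : Fin n →₀ ℕ => Ideal.Quotient.mk (Ideal.span {f}) (monomial e (1 : k))) '' (A : Set _))) ^ K := by
  intro L NL h
  set I := Ideal.span ((fun e : Fin n →₀ ℕ => Ideal.Quotient.mk (Ideal.span {f}) (monomial e (1 : k))) '' (A : Set _)) with hI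
  have hgen : ∀ e ∈ A, Ideal.Quotient.mk (Ideal.span {f}) (monomial e (1 : k)) ∈ I := fun e he =>
    Ideal.subset_span ⟨e, he, rfl⟩
  induction h with
  | nil => simp
  | @cons t s L NL hts _ ih =>
    obtain ⟨hcoef, hdeg, hexp⟩ := hts
    rw [List.map_cons, List.sum_cons, map_add]
    refine Ideal.add_mem _ ?_ ih
    -- the exponent of the numerator term, and `c·x^β = C c · ∏ᵢ (x^{aᵢ})^{eᵢ} · (x^m)^{K-|e|}`
    have hβ' : (Finsupp.equivFunOnFinite.symm s.2 : Fin n →₀ ℕ) = ∑ i : Fin n, t.2 i • a i + (K - ∑ i : Fin n, t.2 i) • m := by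
      ext j
      rw [Finsupp.coe_equivFunOnFinite_symm, hexp j, Finsupp.add_apply, Finsupp.smul_apply, Finsupp.finsetSum_apply,
        smul_eq_mul]
      congr 1
    have hprod : (∏ i : Fin n, (monomial (a i) (1 : k) : MvPolynomial (Fin n) k) ^ t.2 i) =
        monomial (∑ i : Fin n, t.2 i • a i) 1 := by
      rw [monomial_sum_index, C_1, one_mul]
      exact Finset.prod_congr rfl fun i _ => by rw [monomial_pow, one_pow]
    have hβ : (monomial (Finsupp.equivFunOnFinite.symm s.2) ((s.1 : ℤ) : k) : MvPolynomial (Fin n) k) =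
        C ((t.1 : ℤ) : k) * ((∏ i : Fin n, monomial (a i) (1 : k) ^ t.2 i) * monomial m (1 : k) ^ (K - ∑ i : Fin n, t.2 i)) := by
      rw [hprod, monomial_pow, one_pow, monomial_mul, mul_one, C_mul_monomial, mul_one, hcoef, hβ']
    rw [hβ, map_mul, map_mul]
    refine Ideal.mul_mem_left _ _ ?_
    have hsplit : I ^ K = I ^ (∑ i : Fin n, t.2 i) * I ^ (K - ∑ i : Fin n, t.2 i) := by
      rw [← pow_add I, Nat.add_sub_cancel' hdeg]
    rw [hsplit, map_pow]
    refine Ideal.mul_mem_mul ?_ (Ideal.pow_mem_pow (hgen m hmA) _)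
    have hmem : (∏ i : Fin n, Ideal.Quotient.mk (Ideal.span {f}) (monomial (a i) (1 : k)) ^ t.2 i) ∈ ∏ i : Fin n, I ^ t.2 i :=
      Ideal.prod_mem_prod fun i _ => Ideal.pow_mem_pow (hgen (a i) (haA i)) _
    rw [Finset.prod_pow_eq_pow_sum] at hmem
    rw [map_prod]
    simp_rw [map_pow]
    exact hmem

/-- **An element of `R̄[I_A R̄/x̄^m]` with value `r/1 · (x̄^m/1)⁻ᴷ`, `r ∈ (I_A R̄)^K`, IS the numerator form
`reesChartEquiv x̄^m _ (Away.mk K ⟨rtᴷ, _⟩)`** (both have the same value in `R̄[1/x̄^m]`, by `reesChart_mk`). [folklore] -/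
theorem eq_reesChartEquiv_mk_of_val_eq {R : Type} [CommRing R] {I : Ideal R} (u : R) (hu : u ∈ I) (K : ℕ) (r : R) (hr : r ∈ I ^ K)
    (z : ↥(blowupAlgebra I u)) (hz : (z : Localization.Away u) = algebraMap R (Localization.Away u) r * IsLocalization.Away.invSelf u ^ K) :
    z = reesChartEquiv u hu (HomogeneousLocalization.Away.mk (reesGrading I) (reesT_mem u hu) K
      ⟨Polynomial.monomial K r, reesAlgebra.monomial_mem.mpr hr⟩ ⟨r, by simp⟩) := by
  apply Subtype.ext
  rw [hz, coe_reesChartEquiv, reesChart_mk u hu _ (r := r) rfl]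

include haA hmA in
/-- **THE NUMERATOR FORM OF A MODEL ELEMENT.** For a C1-presented chart (`(θ q̄).val = Ψ q`, the first clause of
`MonomialChartPresentationKernel.exists_monomialChartPresentation`) and a y-term list `L` with numerator `NL` at height `K`:
`θ (mk (evalL L)) = reesChartEquiv x̄^m _ (Away.mk K ⟨(mk (evalL NL)) tᴷ⟩)`. This is the bridge from the chart models
(stub-5's `T11Char3Poly.HS`, C1) to the numerator currency of `AffineBlowupChartRestriction.map_ideal_closure_eq_of_memberships`. [folklore] -/
theorem theta_mk_evalL_eq_reesChartEquiv (g : MvPolynomial (Fin n) k)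
    (θ : (MvPolynomial (Fin n) k ⧸ Ideal.span {g}) →+*
      ↥(blowupAlgebra (Ideal.span ((fun e : Fin n →₀ ℕ => Ideal.Quotient.mk (Ideal.span {f}) (monomial e (1 : k))) '' (A : Set _)))
        (Ideal.Quotient.mk (Ideal.span {f}) (monomial m (1 : k)))))
    (hθ : ∀ q : MvPolynomial (Fin n) k, (θ (Ideal.Quotient.mk (Ideal.span {g}) q)).val =
      aeval (fun i : Fin n => algebraMap (MvPolynomial (Fin n) k ⧸ Ideal.span {f})
        (Localization.Away (Ideal.Quotient.mk (Ideal.span {f}) (monomial m (1 : k))))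
        (Ideal.Quotient.mk (Ideal.span {f}) (monomial (a i) (1 : k))) *
        IsLocalization.Away.invSelf (Ideal.Quotient.mk (Ideal.span {f}) (monomial m (1 : k)))) q)
    (hm : Ideal.Quotient.mk (Ideal.span {f}) (monomial m (1 : k)) ∈
      Ideal.span ((fun e : Fin n →₀ ℕ => Ideal.Quotient.mk (Ideal.span {f}) (monomial e (1 : k))) '' (A : Set _)))
    (K : ℕ) (L NL : List (ℤ × (Fin n → ℕ)))
    (hrel : List.Forall₂ (fun t s : ℤ × (Fin n → ℕ) => s.1 = t.1 ∧ (∑ i : Fin n, t.2 i) ≤ K ∧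
      ∀ j : Fin n, s.2 j = (∑ i : Fin n, t.2 i * a i j) + (K - ∑ i : Fin n, t.2 i) * m j) L NL) :
    θ (Ideal.Quotient.mk (Ideal.span {g}) (KLocCellKit.evalL k L)) =
      reesChartEquiv (Ideal.Quotient.mk (Ideal.span {f}) (monomial m (1 : k))) hm
        (HomogeneousLocalization.Away.mk (reesGrading _) (reesT_mem _ hm) K
          ⟨Polynomial.monomial K (Ideal.Quotient.mk (Ideal.span {f}) (KLocCellKit.evalL k NL)),
            reesAlgebra.monomial_mem.mpr (mk_evalL_mem_pow f m a A haA hmA K L NL hrel)⟩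
          ⟨Ideal.Quotient.mk (Ideal.span {f}) (KLocCellKit.evalL k NL), by simp⟩) := by
  refine eq_reesChartEquiv_mk_of_val_eq _ hm K _ (mk_evalL_mem_pow f m a A haA hmA K L NL hrel) _ ?_
  set u := Ideal.Quotient.mk (Ideal.span {f}) (monomial m (1 : k)) with hu
  have hU : IsUnit (algebraMap (MvPolynomial (Fin n) k ⧸ Ideal.span {f}) (Localization.Away u) u ^ K) :=
    (IsLocalization.Away.algebraMap_isUnit u).pow K
  refine hU.mul_left_injective ?_
  simp only
  unfold KLocCellKit.evalL
  rw [hθ, psi_evalL_mul_pow f m a K L NL hrel, mul_assoc, ← mul_pow,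
    mul_comm (IsLocalization.Away.invSelf u), IsLocalization.Away.mul_invSelf, one_pow, mul_one]

end Numerator

/-! ## §3 The «Laurent-graph» primes `(y_S, y^μ·y_r + 1)` -/

section LaurentGraph

variable {k : Type} [Field k] {n : ℕ} (S : Finset (Fin n)) (r : Fin n) (μ : Fin n →₀ ℕ)

/-- The «Laurent-graph» map `k[y] → k[y][1/y^μ]`: `y_s ↦ 0` (`s ∈ S`), `y_r ↦ −(y^μ)⁻¹`, `y_i ↦ y_i` otherwise — written inline as
an `aeval`; it kills `y_s` (`s ∈ S`) and `y^μ·y_r + 1` when `μ` avoids `S ∪ {r}` and `r ∉ S`. [folklore] -/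
theorem aeval_laurentGraph_generators (hr : r ∉ S) (hμS : ∀ s ∈ S, μ s = 0) (hμr : μ r = 0) :
    (∀ s ∈ S, aeval (R := k) (S₁ := Localization.Away (monomial μ (1 : k) : MvPolynomial (Fin n) k))
        (fun i : Fin n => if i ∈ S then 0 else if i = r then
          -IsLocalization.Away.invSelf (monomial μ (1 : k) : MvPolynomial (Fin n) k)
          else algebraMap (MvPolynomial (Fin n) k) _ (X i)) (X s) = 0) ∧
      aeval (R := k) (S₁ := Localization.Away (monomial μ (1 : k) : MvPolynomial (Fin n) k))
        (fun i : Fin n => if i ∈ S then 0 else if i = r then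
          -IsLocalization.Away.invSelf (monomial μ (1 : k) : MvPolynomial (Fin n) k)
          else algebraMap (MvPolynomial (Fin n) k) _ (X i)) (monomial μ (1 : k) * X r + 1) = 0 := by
  set φ := aeval (R := k) (S₁ := Localization.Away (monomial μ (1 : k) : MvPolynomial (Fin n) k))
    (fun i : Fin n => if i ∈ S then 0 else if i = r then
      -IsLocalization.Away.invSelf (monomial μ (1 : k) : MvPolynomial (Fin n) k)
      else algebraMap (MvPolynomial (Fin n) k) _ (X i)) with hφ
  refine ⟨fun s hs => by rw [hφ, aeval_X, if_pos hs], ?_⟩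
  -- the monomial `y^μ` goes to `y^μ/1` (its variables are untouched)
  have hmono : φ (monomial μ (1 : k)) =
      algebraMap (MvPolynomial (Fin n) k) (Localization.Away (monomial μ (1 : k) : MvPolynomial (Fin n) k)) (monomial μ (1 : k)) := by
    rw [hφ, aeval_monomial, (algebraMap k (Localization.Away (monomial μ (1 : k) : MvPolynomial (Fin n) k))).map_one, one_mul,
      monomial_eq, C_1, one_mul, map_finsuppProd]
    refine Finsupp.prod_congr fun i hi => ?_
    have hi' : μ i ≠ 0 := Finsupp.mem_support_iff.mp hi
    have hiS : i ∉ S := fun h => hi' (hμS i h)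
    have hir : i ≠ r := fun h => hi' (h ▸ hμr)
    rw [if_neg hiS, if_neg hir, map_pow]
  rw [map_add φ, map_one φ, map_mul φ, hmono, hφ, aeval_X, if_neg hr, if_pos rfl, mul_neg, IsLocalization.Away.mul_invSelf,
    neg_add_cancel]

/-- **The kernel of the Laurent-graph map is `(y_S, y^μ·y_r + 1)`.** (⊇: the generators die; ⊆: the localisation lift of the quotient
map `k[y] → k[y]/(y_S, y^μ·y_r + 1)` — `y^μ` is a unit there, with inverse `−y_r` — is a left inverse on generators.) [folklore] -/
theorem ker_laurentGraph_eq (hr : r ∉ S) (hμS : ∀ s ∈ S, μ s = 0) (hμr : μ r = 0) :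
    RingHom.ker (aeval (R := k) (S₁ := Localization.Away (monomial μ (1 : k) : MvPolynomial (Fin n) k))
        (fun i : Fin n => if i ∈ S then 0 else if i = r then
          -IsLocalization.Away.invSelf (monomial μ (1 : k) : MvPolynomial (Fin n) k)
          else algebraMap (MvPolynomial (Fin n) k) _ (X i))).toRingHom =
      Ideal.span (((fun s : Fin n => (X s : MvPolynomial (Fin n) k)) '' (S : Set (Fin n))) ∪ {monomial μ (1 : k) * X r + 1}) := by
  set M : MvPolynomial (Fin n) k := monomial μ (1 : k) with hM
  set T := Localization.Away M
  set φ := aeval (R := k) (S₁ := T) (fun i : Fin n => if i ∈ S then 0 else if i = r then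
    -IsLocalization.Away.invSelf M else algebraMap (MvPolynomial (Fin n) k) T (X i)) with hφ
  set J := Ideal.span (((fun s : Fin n => (X s : MvPolynomial (Fin n) k)) '' (S : Set (Fin n))) ∪ {M * X r + 1}) with hJ
  obtain ⟨hgenS, hgenr⟩ := aeval_laurentGraph_generators (k := k) S r μ hr hμS hμr
  apply le_antisymm
  · -- a left inverse: `ψ ∘ φ = mk`, with `ψ` the localisation lift of the quotient map (`M̄` is a unit, inverse `−ȳ_r`)
    have hunit : IsUnit (Ideal.Quotient.mk J M) := by
      refine isUnit_iff_exists_inv.mpr ⟨Ideal.Quotient.mk J (-X r), ?_⟩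
      rw [← map_mul, ← (Ideal.Quotient.mk J).map_one, Ideal.Quotient.eq, show M * -X r - 1 = -(M * X r + 1) by ring,
        Ideal.neg_mem_iff]
      exact Ideal.subset_span (Or.inr rfl)
    let ψ : T →+* MvPolynomial (Fin n) k ⧸ J := IsLocalization.Away.lift M (g := Ideal.Quotient.mk J) hunit
    have hψalg : ∀ q : MvPolynomial (Fin n) k, ψ (algebraMap _ T q) = Ideal.Quotient.mk J q := fun q =>
      IsLocalization.Away.lift_eq M hunit q
    have hcomp : ψ.comp φ.toRingHom = Ideal.Quotient.mk J := by
      refine MvPolynomial.ringHom_ext (fun c => ?_) (fun i => ?_)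
      · rw [RingHom.comp_apply, AlgHom.toRingHom_eq_coe, RingHom.coe_coe, hφ, aeval_C,
          IsScalarTower.algebraMap_apply k (MvPolynomial (Fin n) k) T, MvPolynomial.algebraMap_eq, hψalg]
      · rw [RingHom.comp_apply, AlgHom.toRingHom_eq_coe, RingHom.coe_coe, hφ, aeval_X]
        by_cases hiS : i ∈ S
        · rw [if_pos hiS, map_zero, eq_comm, Ideal.Quotient.eq_zero_iff_mem]
          exact Ideal.subset_span (Or.inl ⟨i, hiS, rfl⟩)
        · rw [if_neg hiS]
          by_cases hir : i = r
          · subst hir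
            rw [if_pos rfl, map_neg]
            -- `ψ(M⁻¹) = (M̄)⁻¹ = −ȳ_r`
            have h1 : ψ (IsLocalization.Away.invSelf M) * Ideal.Quotient.mk J M = 1 := by
              rw [← hψalg M, ← map_mul, mul_comm, IsLocalization.Away.mul_invSelf, map_one]
            have h2 : Ideal.Quotient.mk J (X i) * Ideal.Quotient.mk J M = -1 := by
              rw [← map_mul, ← (Ideal.Quotient.mk J).map_one, ← map_neg, Ideal.Quotient.eq, sub_neg_eq_add, mul_comm]
              exact Ideal.subset_span (Or.inr rfl)
            have h3 : (ψ (IsLocalization.Away.invSelf M) + Ideal.Quotient.mk J (X i)) * Ideal.Quotient.mk J M = 0 := by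
              rw [add_mul, h1, h2, add_neg_cancel]
            have h4 : ψ (IsLocalization.Away.invSelf M) + Ideal.Quotient.mk J (X i) = 0 := hunit.mul_left_eq_zero.mp h3
            exact neg_eq_of_add_eq_zero_right h4
          · rw [if_neg hir, hψalg]
    intro q hq
    rw [RingHom.mem_ker] at hq
    have : Ideal.Quotient.mk J q = 0 := by
      rw [← hcomp, RingHom.comp_apply, hq, map_zero]
    exact Ideal.Quotient.eq_zero_iff_mem.mp this
  · rw [hJ, Ideal.span_le]
    rintro q (⟨s, hs, rfl⟩ | hq)
    · exact hgenS s hs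
    · rw [Set.mem_singleton_iff] at hq
      rw [hq]
      exact hgenr

/-- **The Laurent-graph ideal `(y_S, y^μ·y_r + 1)` is PRIME** (kernel of a map to a domain). [folklore] -/
theorem isPrime_span_laurentGraph (hr : r ∉ S) (hμS : ∀ s ∈ S, μ s = 0) (hμr : μ r = 0) :
    (Ideal.span (((fun s : Fin n => (X s : MvPolynomial (Fin n) k)) '' (S : Set (Fin n))) ∪
      {monomial μ (1 : k) * X r + 1})).IsPrime := by
  haveI : IsDomain (Localization.Away (monomial μ (1 : k) : MvPolynomial (Fin n) k)) :=
    IsLocalization.isDomain_localization (M := Submonoid.powers (monomial μ (1 : k) : MvPolynomial (Fin n) k))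
      (powers_le_nonZeroDivisors_of_noZeroDivisors (monomial_eq_zero.not.mpr one_ne_zero))
  rw [← ker_laurentGraph_eq S r μ hr hμS hμr]
  exact RingHom.ker_isPrime _

/-- **A monomial avoiding `y_S` is NOT in `(y_S, y^μ·y_r + 1)`** (its image `±(y^{ν'})/(y^μ)^{ν_r}` in the domain `k[y][1/y^μ]` is
non-zero). [folklore] -/
theorem not_mem_span_laurentGraph_of_monomial (hr : r ∉ S) (hμS : ∀ s ∈ S, μ s = 0) (hμr : μ r = 0) (ν : Fin n →₀ ℕ)
    (hνS : ∀ s ∈ S, ν s = 0) {c : k} (hc : c ≠ 0) :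
    (monomial ν c : MvPolynomial (Fin n) k) ∉ Ideal.span (((fun s : Fin n => (X s : MvPolynomial (Fin n) k)) '' (S : Set (Fin n))) ∪
      {monomial μ (1 : k) * X r + 1}) := by
  set M : MvPolynomial (Fin n) k := monomial μ (1 : k) with hM
  set T := Localization.Away M
  haveI : IsDomain T :=
    IsLocalization.isDomain_localization (M := Submonoid.powers M)
      (powers_le_nonZeroDivisors_of_noZeroDivisors (monomial_eq_zero.not.mpr one_ne_zero))
  rw [← ker_laurentGraph_eq S r μ hr hμS hμr, RingHom.mem_ker]
  have hinj : Function.Injective (algebraMap (MvPolynomial (Fin n) k) T) :=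
    IsLocalization.injective (M := Submonoid.powers M) T
      (powers_le_nonZeroDivisors_of_noZeroDivisors (monomial_eq_zero.not.mpr one_ne_zero))
  -- the image is `c · ∏_{i ≠ r} (X i/1)^{ν i} · (−M⁻¹)^{ν r}`, a product of non-zero elements of a domain
  rw [AlgHom.toRingHom_eq_coe, RingHom.coe_coe, aeval_monomial]
  refine mul_ne_zero ?_ ?_
  · rw [IsScalarTower.algebraMap_apply k (MvPolynomial (Fin n) k) T, MvPolynomial.algebraMap_eq]
    exact fun h => hc (C_eq_zero.mp (hinj (h.trans (map_zero _).symm)))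
  · rw [Finsupp.prod]
    refine Finset.prod_ne_zero_iff.mpr fun i hi => pow_ne_zero _ ?_
    have hi' : ν i ≠ 0 := Finsupp.mem_support_iff.mp hi
    have hiS : i ∉ S := fun h => hi' (hνS i h)
    rw [if_neg hiS]
    by_cases hir : i = r
    · rw [if_pos hir, neg_ne_zero]
      intro h0
      have := IsLocalization.Away.mul_invSelf (S := T) M
      rw [h0, mul_zero] at this
      exact zero_ne_one this
    · rw [if_neg hir]
      exact fun h => X_ne_zero (R := k) i (hinj (h.trans (map_zero _).symm))

end LaurentGraph

end Summit.ResolutionOfSingularities.ResolutionOfSingularities.Theorems.FInjectiveMacaulayfication.ChartModelNumerators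

end
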